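import Literature.NumberTheory.ComplexMultiplication.EllipticUnits.ImaginaryQuadraticMainConjectureCarriersCores
import Literature.NumberTheory.GaloisCohomology.ShaRestrictedShapiroLayerChange
import Literature.NumberTheory.GaloisCohomology.ShaRestrictedShapiroLayerConj
import HarnessLib

/-!
# The level groups `H^i(G_S(F), μ_{p^k} ⊗ θ)` of Johnson-Leung–Kings 2011 Def. 4.2 (94) under the Ш-condition
# transport: `relCores` / `levelRed` / `levelConj` ARE the transported trace / coefficient reduction / right translation
# of `Hⁱ(G_S, (Ind_U^{Γ_K} μ_{p^k} ⊗ θ)^{N_S})` (Serre I §2.5; NSW (1.5.3)–(1.6.5))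

Topic `Literature/NumberTheory/ComplexMultiplication/EllipticUnits` (grouping sub-namespace `JohnsonLeungKings2011`).
THEOREMS ONLY (no definition, no named fact, no `sorry`, no instance, no notation).  PLUG FILE: it keys the generic
layer-change dictionary of the Ш-condition transport (`GaloisCohomology/ShaRestrictedShapiroLayerChange`, (S-cor)/(S-res)/
(S-coeff), and `…ShaRestrictedShapiroLayerConj`, (S-conj); width seat `bsd-line-cf2c-w3` g9/g10 of cell `bsd-print-cf2`) to the
NAMES of the pinned carriers of [JLK] Thm. 5.2 / Cor. 5.3 (`ImaginaryQuadraticMainConjectureCarriers`: `levelCoh`, `relCores`,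
`levelRed`, `levelConj` of typer `bsd-print-cf2-ty2`), for the discrete `Γ_K`-module `ρ = muTwist p θ k = μ_{p^k} ⊗ θ` and an
open normal `U = Gal(K̄/F) ≤ Γ_K` containing `N_S` (so `levelCoh p S θ U k i = Hⁱ(U.map π, (μ_{p^k} ⊗ θ)^{N_S})` IS the layer
ambient of the transport, `levelCoh_eq_layer`, `rfl`).  With `sh_U = ShaLayer.layerShapiroEquiv S (muTwist p θ k) U hU i`,
`T_U = ShaLayer.restrictedCohomologyEquiv S (muTwist p θ k) U hU hUS hθ i` (the Ш-condition transport of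
`ShaRestrictedShapiroLayer`, `Hⁱ(G_S, (Maps(Γ_K ⧸ U, μ_{p^k} ⊗ θ))^{N_S}) ≃+ Hⁱ(G_S, Maps(G_S ⧸ U_S, ·)) ≃+ levelCoh p S θ U k i`):

* §1 `relCores_eq_relCor` — ty2's `relCores p S θ h hU hU' k i` IS the tree's all-degree relative corestriction
  `relCor (imGS S U) (imGS S U') (coeffGS p S θ k)` (`RelativeCorestrictionConj`), for any `Fintype` instance;
* §2 **`transport_coindFinSum_eq_relCores`**: `sh_U (T_U (Hⁱ(G_S, Σ_{U′→U}) c)) = relCores p S θ h hU hU′ k i (sh_{U′} (T_{U′} c))`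
  — the trace `Ind_{U′} → Ind_U` (fibre sum `coindFinSum`) becomes the corestriction `cor_{F′/F}` of Def. 4.2 (94) / Def. 3.5;
* §3 **`transport_coindFinMap_eq_levelRed`**: for any morphism `F : μ_{p^{k+1}} ⊗ θ → μ_{p^k} ⊗ θ` of discrete `Γ_K`-modules
  that is `ζ ↦ ζ^p` on roots of unity, `sh_U (T_U (Hⁱ(G_S, Maps(F)) c)) = levelRed p S θ U k i (sh_U (T_U c))`;
* §4 **`transport_rTransHom_eq_levelConj_one/_two`**: `sh_U (T_U (Hⁱ(G_S, R_{γU}) c)) = levelConj p S θ U k i γ (sh_U (T_U c))`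
  (`i = 1, 2`) — the right translation by `γU` on `Ind_U` becomes the conjugation operator through which `Λ₂` acts;
* (S-res) is `ShaLayer.layerShapiroEquiv_transport_coindFinRes` verbatim (`resLe` on `levelCoh`; ty2 names no restriction).

Consumer: ROW 1 of the JLK descent on crux stmt-BirchSwinnertonDyer-24721 (cell `bsd-print-cf2`, seat `bsd-line-cf2c-w8`):
the level maps `C.X → layerCoh p κ₁ κ₂ θ 𝔣 n k i` built from the layer Poitou–Tate pairings are compatible with
`layerCores` / `layerRed` / `layerConj` (= `relCores` / `levelRed` / `levelConj` at `U = pairLayerSubgroup κ₁ κ₂ n`,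
`S = suppPF p 𝔣`), hence glue into `IwasawaCohomologyData.H` (`exists_linearMap_of_levelMaps`).  HONEST FRAMING: bookkeeping
of continuous cohomology; nothing about elliptic units, `L`-functions or BSD is proved here.

## References
* [JohnsonLeungKings2011] J. Johnson-Leung, G. Kings, J. reine angew. Math. 653 (2011), §4.2 Def. 4.2 (94) (arXiv
  p0012:L80–112: the inverse system `lim←_{K ⊂ K_n ⊂ K_∞} H^i(𝒪_{K_n}[1/p], 𝒪_p(η))` and its `Λ`-structure), Def. 3.5
  (p0010:L72–80, the traces `tr_{K(𝔪)/F}`).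
* [SerreGaloisCohomology1997] J.-P. Serre, *Galois Cohomology* (1997), I §2.5 (`cor = H(π) ∘ sh⁻¹`).
* [NeukirchSchmidtWingberg2008] J. Neukirch, A. Schmidt, K. Wingberg, *Cohomology of Number Fields* (2008), I §5 Prop.
  (1.5.3)–(1.5.4), I §6 Prop. (1.6.4)–(1.6.5).
* [SerreLocalFields1979] J.-P. Serre, *Local Fields* (1979), VII §5 (the action of `G/H` on `H^q(H, A)`).
* [Kato2004Asterisque] K. Kato, Astérisque 295 (2004), §8.2 (p. 180) (`H^q(R, T) = lim←_k H^q(R, T/p^k)`).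
-/

noncomputable section

open scoped NumberField
open CategoryTheory Field IsDedekindDomain
open Literature.NumberTheory.GaloisRepresentations
open Literature.NumberTheory.GaloisRepresentations.DiscreteGaloisModule
open Literature.NumberTheory.GaloisCohomology.ShaLayer

namespace Literature.NumberTheory.ComplexMultiplication.EllipticUnits.JohnsonLeungKings2011

variable {K : Type} [Field K] [NumberField K] (p : ℕ) [Fact p.Prime]
  (S : Set (HeightOneSpectrum (𝓞 K))) (θ : absoluteGaloisGroup K →ₜ* ℤ_[p]ˣ)
variable {U U' : Subgroup (absoluteGaloisGroup K)} [U.Normal] [U'.Normal]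
  (hU : IsOpen (U : Set (absoluteGaloisGroup K))) (hU' : IsOpen (U' : Set (absoluteGaloisGroup K))) (h : U' ≤ U)

/-! ## §1 The level groups are the layer ambient; `relCores` is the tree's `relCor` -/

omit [NumberField K] [U.Normal] in
/-- **`levelCoh p S θ U k i = Hⁱ(U.map π, (μ_{p^k} ⊗ θ)^{N_S})`**: ty2's level group IS the layer ambient
`continuousCohomology i (subgroupRep ((muTwist p θ k).quotientInvariants N_S).toTopRep (U.map (toUnramifiedQuot K S)))` of the
Ш-condition transport (`ShaRestrictedLayerTransport`), definitionally (`imGS S U = U.map π`, `levelRep = restrict`).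
[cite: JohnsonLeungKings2011, Def. 4.2 (94) (arXiv p0012:L94)] -/
theorem levelCoh_eq_layer (k i : ℕ) :
    levelCoh p S θ U k i =
      ((continuousCohomology i (subgroupRep ((muTwist p θ k).quotientInvariants (ramificationSubgroup K S)).toTopRep
        (U.map (toUnramifiedQuot K S))) : TopModuleCat ℤ) : Type) := rfl

omit [U.Normal] [U'.Normal] in
/-- **ty2's `relCores` IS the tree's all-degree relative corestriction `relCor`** (`RelativeCorestrictionConj`:
`cor_{U'_S.subgroupOf U_S} ∘ toSubgroupOf`) of the ONE ambient `G_S`-module `coeffGS p S θ k` along `imGS S U' ≤ imGS S U`,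
for ANY `Fintype` instance on the index set (`relCores` carries `Fintype.ofFinite`).
[cite: SerreGaloisCohomology1997, I §2.5] [cite: JohnsonLeungKings2011, Def. 4.2 (94) (arXiv p0012:L94)] -/
theorem relCores_eq_relCor (k i : ℕ)
    [inst : Fintype (↥(U.map (toUnramifiedQuot K S)) ⧸
      (U'.map (toUnramifiedQuot K S)).subgroupOf (U.map (toUnramifiedQuot K S)))] (c : levelCoh p S θ U' k i) :
    haveI : TotallyDisconnectedSpace (GaloisGroupUnramifiedOutside K S) :=
      Literature.GroupTheory.ProfiniteSubquotients.totallyDisconnectedSpace_quotient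
        (ramificationSubgroup K S) (ramificationSubgroup_isClosed K S)
    haveI : IsClosed ((U.map (toUnramifiedQuot K S) : Subgroup (GaloisGroupUnramifiedOutside K S)) :
        Set (GaloisGroupUnramifiedOutside K S)) := isClosed_imGS' S hU
    haveI : IsClosed ((U'.map (toUnramifiedQuot K S) : Subgroup (GaloisGroupUnramifiedOutside K S)) :
        Set (GaloisGroupUnramifiedOutside K S)) := isClosed_imGS' S hU'
    relCores p S θ h hU hU' k i c =
      relCor (U.map (toUnramifiedQuot K S)) (U'.map (toUnramifiedQuot K S)) (coeffGS p S θ k) (Subgroup.map_mono h) i c := by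
  haveI : ((U'.map (toUnramifiedQuot K S)).subgroupOf (U.map (toUnramifiedQuot K S))).FiniteIndex := by
    haveI : (U'.map (toUnramifiedQuot K S)).FiniteIndex := finiteIndex_imGS' S hU'
    infer_instance
  have e : inst = Fintype.ofFinite _ := Subsingleton.elim _ _
  subst e
  rfl

/-! ## §2 (S-cor): the trace `Ind_{U′} → Ind_U` transports to `relCores` -/

section Cor

variable [U.FiniteIndex] [U'.FiniteIndex] (hUS : ramificationSubgroup K S ≤ U) (hU'S : ramificationSubgroup K S ≤ U')
  (k : ℕ) (hθ : ramificationSubgroup K S ≤ ContinuousRep.ker (muTwist p θ k))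

/-- **(S-cor), JLK currency: `sh_U (T_U (Hⁱ(G_S, Σ_{U′→U}) c)) = relCores p S θ h hU hU′ k i (sh_{U′} (T_{U′} c))`**, every degree —
under the Ш-condition transport the trace `Maps(Γ_K ⧸ U′, μ_{p^k} ⊗ θ) → Maps(Γ_K ⧸ U, ·)` (fibre sum `coindFinSum`, acting on
`Hⁱ(G_S, ·^{N_S})` through `invariantsHom`) becomes ty2's corestriction `relCores = cor_{F′/F}` of the level groups of
Def. 4.2 (94) (= the traces `tr` of Def. 3.5).  `Fintype` instances on `Γ_K ⧸ U′`, `G_S ⧸ U′_S` arbitrary; `[U.FiniteIndex]` from `finiteIndex_of_isOpen'`.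
[cite: JohnsonLeungKings2011, Def. 4.2 (94) (arXiv p0012:L94) and Def. 3.5 (p0010:L72–80)] [cite: SerreGaloisCohomology1997, I §2.5]
[cite: NeukirchSchmidtWingberg2008, I §5 Prop. (1.5.3), I §6 Prop. (1.6.4)–(1.6.5)] -/
theorem transport_coindFinSum_eq_relCores [Fintype (absoluteGaloisGroup K ⧸ U')]
    [Fintype (GaloisGroupUnramifiedOutside K S ⧸ U'.map (toUnramifiedQuot K S))] (i : ℕ)
    (c : restrictedCohomology ((muTwist p θ k).coindOpen U' hU') S i) :
    layerShapiroEquiv S (muTwist p θ k) U hU i (restrictedCohomologyEquiv S (muTwist p θ k) U hU hUS hθ i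
        ((ContinuousCohomology.map (ContinuousMonoidHom.id (GaloisGroupUnramifiedOutside K S))
          (ContinuousRep.invariantsHom (N := ramificationSubgroup K S) (ρ := (muTwist p θ k).coindOpen U' hU')
            (ρ' := (muTwist p θ k).coindOpen U hU) (coindFinSum (muTwist p θ k).toTopRep h)) i).hom c)) =
      relCores p S θ h hU hU' k i
        (layerShapiroEquiv S (muTwist p θ k) U' hU' i (restrictedCohomologyEquiv S (muTwist p θ k) U' hU' hU'S hθ i c)) := by
  haveI : ((U'.map (toUnramifiedQuot K S)).subgroupOf (U.map (toUnramifiedQuot K S))).FiniteIndex := by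
    haveI : (U'.map (toUnramifiedQuot K S)).FiniteIndex := finiteIndex_imGS' S hU'
    infer_instance
  letI : Fintype (↥(U.map (toUnramifiedQuot K S)) ⧸
      (U'.map (toUnramifiedQuot K S)).subgroupOf (U.map (toUnramifiedQuot K S))) := Fintype.ofFinite _
  exact (layerShapiroEquiv_transport_coindFinSum S (muTwist p θ k) U U' hU hU' h hUS hU'S hθ i c).trans
    (relCores_eq_relCor p S θ hU hU' h k i _).symm

end Cor

/-! ## §3 (S-coeff): `Maps(ζ ↦ ζ^p)` transports to `levelRed` -/

section Red

variable [U.FiniteIndex] (hUS : ramificationSubgroup K S ≤ U) (k : ℕ)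
  (hθ₁ : ramificationSubgroup K S ≤ ContinuousRep.ker (muTwist p θ (k + 1)))
  (hθ : ramificationSubgroup K S ≤ ContinuousRep.ker (muTwist p θ k))

omit [U'.Normal] in
/-- **(S-coeff), JLK currency: `sh_U (T_U (Hⁱ(G_S, Maps(F)) c)) = levelRed p S θ U k i (sh_U (T_U c))`**, every degree, for ANY
morphism `F : μ_{p^{k+1}} ⊗ θ → μ_{p^k} ⊗ θ` of discrete `Γ_K`-modules which is `ζ ↦ ζ^p` on the underlying roots of unity
(`hF`; ty2's `levelRedHom` is that map on the `N_S`-invariants, `coe_coeffRed`) — the transition maps in `k` of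
`H^i(𝒪_F[1/S], 𝒪_p(χ)(1)) = lim←_k H^i(𝒪_F[1/S], 𝒪_p(χ)(1)/p^k)`. [cite: Kato2004Asterisque, §8.2 (p. 180)]
[cite: JohnsonLeungKings2011, Def. 4.2 (arXiv p0012:L80–95)] [cite: NeukirchSchmidtWingberg2008, I §6 Prop. (1.6.4)–(1.6.5)] -/
theorem transport_coindFinMap_eq_levelRed (F : (muTwist p θ (k + 1)).toTopRep ⟶ (muTwist p θ k).toTopRep)
    (hF : ∀ v : MuCarrier K (p ^ (k + 1)),
      (F.hom v : MuCarrier K (p ^ k)) = muPowMap K (pow_dvd_pow p (Nat.le_succ k)) v)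
    (i : ℕ) (c : restrictedCohomology ((muTwist p θ (k + 1)).coindOpen U hU) S i) :
    layerShapiroEquiv S (muTwist p θ k) U hU i (restrictedCohomologyEquiv S (muTwist p θ k) U hU hUS hθ i
        ((ContinuousCohomology.map (ContinuousMonoidHom.id (GaloisGroupUnramifiedOutside K S))
          (ContinuousRep.invariantsHom (N := ramificationSubgroup K S) (ρ := (muTwist p θ (k + 1)).coindOpen U hU)
            (ρ' := (muTwist p θ k).coindOpen U hU) (coindFinMap F U)) i).hom c)) =
      levelRed p S θ U k i (layerShapiroEquiv S (muTwist p θ (k + 1)) U hU i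
        (restrictedCohomologyEquiv S (muTwist p θ (k + 1)) U hU hUS hθ₁ i c)) := by
  refine (layerShapiroEquiv_transport_coindFinMap S (muTwist p θ (k + 1)) (muTwist p θ k) U hU hUS hθ₁ hθ F i c).trans
    ?_
  rw [levelRed_apply]
  exact congrArg (fun T => TopModuleCat.Hom.hom T (layerShapiroEquiv S (muTwist p θ (k + 1)) U hU i
      (restrictedCohomologyEquiv S (muTwist p θ (k + 1)) U hU hUS hθ₁ i c)))
    (continuousCohomology_map_congr rfl
      (resIdHom (subgroupRepMap (ContinuousRep.invariantsHom (N := ramificationSubgroup K S) F)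
        (U.map (toUnramifiedQuot K S))))
      (levelRedHom p S θ U k) (fun w => Subtype.ext (hF (w : MuCarrier K (p ^ (k + 1))))) i)

end Red

/-! ## §4 (S-conj): the right translation `R_{γU}` transports to `levelConj` (`i = 1, 2`) -/

section Conj

variable [U.FiniteIndex] (hUS : ramificationSubgroup K S ≤ U) (k : ℕ)
  (hθ : ramificationSubgroup K S ≤ ContinuousRep.ker (muTwist p θ k))

omit [U'.Normal] in
/-- **(S-conj), JLK currency, degree `1`: `sh_U (T_U (H¹(G_S, R_{γU}) c)) = levelConj p S θ U k 1 γ (sh_U (T_U c))`** — the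
`Γ_K ⧸ U`-action on `Ind_U (μ_{p^k} ⊗ θ)` by right translations (`coindOpenRTrans`, "sur le second facteur") becomes ty2's
conjugation operator, through which `1 + T_i ↦ γ_i` makes the Iwasawa cohomology a `Λ₂`-module (§4.2).
[cite: JohnsonLeungKings2011, §4.2 (arXiv p0012:L109–112)] [cite: SerreLocalFields1979, VII §5] [cite: NeukirchSchmidtWingberg2008, I §6 Prop. (1.6.5)] -/
theorem transport_rTransHom_eq_levelConj_one (γ : absoluteGaloisGroup K)
    (c : restrictedCohomology ((muTwist p θ k).coindOpen U hU) S 1) :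
    layerShapiroEquiv S (muTwist p θ k) U hU 1 (restrictedCohomologyEquiv S (muTwist p θ k) U hU hUS hθ 1
        ((ContinuousCohomology.map (ContinuousMonoidHom.id (GaloisGroupUnramifiedOutside K S))
          (ContinuousRep.invariantsHom (N := ramificationSubgroup K S)
            ((muTwist p θ k).coindOpenRTrans U hU (QuotientGroup.mk γ : absoluteGaloisGroup K ⧸ U))) 1).hom c)) =
      levelConj p S θ U k 1 γ (layerShapiroEquiv S (muTwist p θ k) U hU 1
        (restrictedCohomologyEquiv S (muTwist p θ k) U hU hUS hθ 1 c)) := by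
  exact layerShapiroEquiv_transport_rTransHom_one S (muTwist p θ k) U hU hUS hθ γ c

omit [U'.Normal] in
/-- **(S-conj), JLK currency, degree `2`** (as `…_one`). [cite: JohnsonLeungKings2011, §4.2 (arXiv p0012:L109–112)]
[cite: SerreLocalFields1979, VII §5] [cite: NeukirchSchmidtWingberg2008, I §6 Prop. (1.6.5)] -/
theorem transport_rTransHom_eq_levelConj_two (γ : absoluteGaloisGroup K)
    (c : restrictedCohomology ((muTwist p θ k).coindOpen U hU) S 2) :
    layerShapiroEquiv S (muTwist p θ k) U hU 2 (restrictedCohomologyEquiv S (muTwist p θ k) U hU hUS hθ 2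
        ((ContinuousCohomology.map (ContinuousMonoidHom.id (GaloisGroupUnramifiedOutside K S))
          (ContinuousRep.invariantsHom (N := ramificationSubgroup K S)
            ((muTwist p θ k).coindOpenRTrans U hU (QuotientGroup.mk γ : absoluteGaloisGroup K ⧸ U))) 2).hom c)) =
      levelConj p S θ U k 2 γ (layerShapiroEquiv S (muTwist p θ k) U hU 2
        (restrictedCohomologyEquiv S (muTwist p θ k) U hU hUS hθ 2 c)) := by
  exact layerShapiroEquiv_transport_rTransHom_two S (muTwist p θ k) U hU hUS hθ γ c

end Conj

end Literature.NumberTheory.ComplexMultiplication.EllipticUnits.JohnsonLeungKings2011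

end
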